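import Mathlib
import HarnessLib
import Summits.CriticalPhenomena.PercolationContinuityZ3.Theses.PercLowPointHalfSpace
import Summits.CriticalPhenomena.PercolationContinuityZ3.Theorems.PercLowPointHalfSpaceLowPointBookkeepingGlue
import Summits.CriticalPhenomena.PercolationContinuityZ3.Theorems.PercLowPointHalfSpaceLowPointBookkeepingOfSharpStubs
import Summits.CriticalPhenomena.PercolationContinuityZ3.Theorems.PercLowPointHalfSpaceLowPointBookkeepingSharpReduce
import Summits.CriticalPhenomena.PercolationContinuityZ3.Theorems.PercLowPointHalfSpaceLowPointBookkeepingStubDilutionToolkit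
import Summits.CriticalPhenomena.PercolationContinuityZ3.Theorems.LowPointBookkeeping.Negative.LogicalStatus
import Literature.Probability.Percolation.HalfSpaceFloorDilution

/-!
# Skeleton `replica-holder` for the crux `LowPointBookkeeping` (stmt-CriticalPhenomena-14713)

Crux-strategist line (wall-breaker seat p1, 2026-08-17).  K = `A → B → C → [P_{p_c}(0 ↔ n e₀) → 0]`.

## Idea

The landed floor-Russo chassis of line SketchIdeator1 reduces K (indeed `θ(p_c(ℤ³)) = 0`) to a
uniform bound `Σ_{w ∈ W_L} Σ_{v ∈ ℍ₊} P_s(0 ↔_ℍ v, e ↔_ℍ v + w, 0 ↮_ℍ e) ≤ C L^{3-ε}` on the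
expected WINDOW PAIR COUNT of two ℍ-disjoint clusters at ADJACENT floor roots `0, e` under the
floor-diluted measures `P_s` (`FloorRusso.Glue.windowSum_le`, landed).  SketchIdeator1 bounds that
count by Markov truncation with one-cluster mass tails and therefore needs, in the FAR classes
`|v| = ρ ≥ 8L` (where it can only bound `|C_e ∩ (v + W_L)|` by `|W_L|`), the two-arm exponent
`a₂ > m = 11/4` — the hypothesis A♯ₛ, strictly stronger than the route's crux A (`5/2 + κ`).

This line re-counts the far classes:

* HÖLDER against the two-arm event `A(ρ/2)`:
  `E[N_ρ] ≤ P_s(A(ρ/2))^{1-1/q} · (E_s[1_{0↮e} X_ρ(ω,ω)^q])^{1/q}` (keeps the fraction `1 - 1/q` of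
  A's exponent), where `X_ρ(ω,ω')` is the class-`ρ` window pair count with the first cluster read in
  `ω` and the second in `ω'`;
* REPLICA DECOUPLING (`stub_replicaDecoupling`, a LEMMA): `E_s[1_{0↮e} X_ρ(ω,ω)^q] ≤
  (E_s ⊗ E_s)[X_ρ(ω,ω')^q]` — conditionally on `C_ℍ(0) = W ∌ e` the cluster of `e` is percolation
  off `W̄`, dominated by an INDEPENDENT unconditioned copy (spatial Markov property + monotone
  coupling; equivalently van den Berg–Häggström–Kahn, RSA 29 (2006) Thm 1.4, + Harris);
* the q-moments of the overlap of two INDEPENDENT wall clusters at window resolution `L` in the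
  shell `ρ` (`stub_replicaOverlapMoments`, the NEW one-cluster-law hypothesis, exponent `2m-3 = 5/2`).

Exponent ledger (m = 11/4): far classes `Σ_{ρ=2^j ≥ 8L} (ρ/2)^{-(5/2+κ)(1-1/q)} C_q L³ ρ^{5/2}
≤ C L^{3-κ/2}` for `q ≥ (5+2κ)/κ`; near classes `2^j < 8L` are the landed two-factor Markov
truncation, which already closes at `a₂ = 5/2 + κ` (`L^{3-κ} log² L`).  So the two-arm input is the
crux-A event at A's OWN exponent `5/2 + κ` (uniformly in the floor density `s`:
`stub_twoArmFloorDilutedE1`), not `11/4 + κ`.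

## Registered stubs (sorries live ONLY here)

* `stub_twoArmFloorDilutedE1` — HYPOTHESIS A_s: crux A's event and exponent `5/2+κ`, under
  `P^{ℍ}_{p_c,s}` for all `s` (A♯ₛ ⇒ A_s ⇒ A; MC a₂(s) = 2.90–2.97, kit j015667/j015398).
* `stub_noFatHalfBoxOrigin` — HYPOTHESIS B♯, verbatim the canonical registered stub of SketchIdeator1
  (near-class mass tails through the landed `stub_dilutionToolkit`).
* `stub_replicaOverlapMoments` — HYPOTHESIS (new): q-moments of the window-resolution overlap of two
  INDEPENDENT wall clusters in the far shells, at exponent `5/2` (real world `2d_f - 3 ≈ 2.05`).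
* `stub_replicaDecoupling` — LEMMA: the q-moment of the pair count on `{0 ↮_ℍ e}` is dominated by its
  value on two independent replicas.
* `stub_holderDyadic` — LEMMA: Hölder + dyadic classes + the landed near-class truncation give the
  window pair bound `≤ C L^{3-κ/2}` from the four inputs above.

Composition (`LowPointBookkeeping_of`, no sorry): symmetry (four neighbours from `e = (0,1,0)`,
`Reduce.real_twoArm_signedPerm`), five half-boxes (`Reduce.noFatHalfBox_of_origin`), tails
(`stub_dilutionToolkit`), pair bound (`stub_holderDyadic`), window sum (`Glue.windowSum_le`),
window average → 0, `θ(p_c) = 0` (`Grimmett1999_theta_sq_le_openConn_holds`), K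
(`LowPointBookkeeping.Negative.lowPointBookkeeping_iff_assembly`).
-/

noncomputable section

open MeasureTheory Filter Topology
open Literature.Probability.Percolation Literature.Probability.LatticeModels
open scoped ENNReal

namespace Summit.CriticalPhenomena.PercolationContinuityZ3.Cruxes.LowPointBookkeeping.ReplicaHolder

open Summit.CriticalPhenomena.PercolationContinuityZ3.Theses.PercLowPointHalfSpace
open Summit.CriticalPhenomena.PercolationContinuityZ3.Theorems
open Summit.CriticalPhenomena.PercolationContinuityZ3.Theorems.FloorRusso.Coupling (pivAt μH)

/-! ## Notation -/

/-- The critical bond percolation measure on `ℤ³`. -/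
local notation3 (prettyPrint := false) "μc" =>
  (bondPercolation (zdGraph 3) (criticalProbI 3) : Measure (BondConfig (Site 3)))

/-- The closed half-space `ℍ = {x₀ ≥ 0}`. -/
local notation3 (prettyPrint := false) "ℍ₃" => ({x : Site 3 | 0 ≤ x 0} : Set (Site 3))

/-- The four floor neighbours of the origin. -/
local notation3 (prettyPrint := false) "𝒩" =>
  ({Pi.single 1 1, Pi.single 1 (-1), Pi.single 2 1, Pi.single 2 (-1)} : Finset (Site 3))

/-- The window `W_L = B_L + 2L e₀`. -/
local notation3 (prettyPrint := false) "𝑾⟦" L "⟧" =>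
  ((box 3 L).image fun y : Site 3 => y + Pi.single 0 (((2 * L : ℕ)) : ℤ))

/-- The boundary one-arm event `arm_ℍ(0, r)`. -/
local notation3 (prettyPrint := false) "𝑻⟦" r "⟧" =>
  ({ω | ∃ y : Site 3, (∃ i : Fin 3, ((r : ℕ) : ℤ) ≤ |y i|) ∧ ω ∈ openConnIn ℍ₃ 0 y} :
    Set (BondConfig (Site 3)))

/-- The two-arm event at the floor neighbour `e` and scale `r` (verbatim crux A's event). -/
local notation3 (prettyPrint := false) "𝑱⟦" e "," r "⟧" =>
  (({ω | ∃ y : Site 3, (∃ i : Fin 3, ((r : ℕ) : ℤ) ≤ |y i|) ∧ ω ∈ openConnIn {x : Site 3 | 0 ≤ x 0} 0 y} ∩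
      {ω | ∃ y : Site 3, (∃ i : Fin 3, ((r : ℕ) : ℤ) ≤ |y i - e i|) ∧ ω ∈ openConnIn {x : Site 3 | 0 ≤ x 0} e y} ∩
      (openConnIn {x : Site 3 | 0 ≤ x 0} 0 e)ᶜ : Set (BondConfig (Site 3))))

/-- The dyadic class `S_j = {v ∈ ℍ₊ : 2^j ≤ |v|_∞ < 2^{j+1}}` of the lower point `v`. -/
local notation3 (prettyPrint := false) "𝑺⟦" j "⟧" =>
  ({v : Site 3 | 1 ≤ v 0 ∧ (∃ i : Fin 3, (((2 ^ j : ℕ)) : ℤ) ≤ |v i|) ∧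
      ∀ i : Fin 3, |v i| < (((2 ^ (j + 1) : ℕ)) : ℤ)} : Set (Site 3))

/-- The class-`j` window pair count with the cluster of `0` read in `ω` and the cluster of `e` read in
`ω'`: `X_j(ω,ω') = #{(v,w) ∈ S_j × W_L : 0 ↔_ℍ v in ω, e ↔_ℍ v + w in ω'}` (as an `ℝ≥0∞` sum). -/
local notation3 (prettyPrint := false) "𝑿⟦" e "," L "," j "," ω "," ω' "⟧" =>
  (∑ w ∈ 𝑾⟦L⟧, ∑' v : Site 3,
    (𝑺⟦j⟧).indicator (fun _ => (1 : ℝ≥0∞)) v *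
      ((openConnIn ℍ₃ (0 : Site 3) v).indicator (fun _ => (1 : ℝ≥0∞)) ω *
        (openConnIn ℍ₃ e (v + w)).indicator (fun _ => (1 : ℝ≥0∞)) ω'))

/-! ## Registered stubs (sorries live ONLY here) -/

/-- **stub_twoArmFloorDilutedE1 (A_s; OPEN hypothesis)**: under `P^{ℍ}_{p_c,s}`, uniformly in the
floor density `s`, the probability that `C_ℍ(0)` and `C_ℍ(e)`, `e = (0,1,0)`, are ℍ-disjoint and both
reach sup-distance `r` is `≤ C r^{-(5/2+κ)}` for some `κ > 0` — the route's crux-A event AND crux A's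
own exponent `5/2 + κ` (crux A is the case `s = 1`); strictly weaker than SketchIdeator1's A♯ₛ
(`11/4 + κ`).  Saturation prediction `a₂ = 3`; MC `a₂(s) = 2.90–2.97` flat in `s` (kit j015667). -/
theorem stub_twoArmFloorDilutedE1 :
    ∃ κ C : ℝ, 0 < κ ∧ ∀ s : unitInterval, ∀ r : ℕ, 1 ≤ r →
      (floorDilutedPercolation 3 (criticalProbI 3) s).real 𝑱⟦(Pi.single 1 1 : Site 3), r⟧ ≤
        C * (r : ℝ) ^ (-(5 / 2 + κ)) := by
  sorry

/-- **stub_noFatHalfBoxOrigin (B♯; OPEN hypothesis, verbatim the canonical registered stub of line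
SketchIdeator1)**: at `p_c(ℤ³)`, on the induced half-space graph, the largest ℍ-cluster trace in the
half-box `B_n ∩ ℍ` has `≥ C n^{11/4}` vertices with probability `≤ 1/e` (real world `n^{2.52}`). -/
theorem stub_noFatHalfBoxOrigin :
    ∃ C : ℝ, 0 < C ∧ ∀ n : ℕ, 1 ≤ n →
      (floorDilutedPercolation 3 (criticalProbI 3) 1).real
        {ω | C * (n : ℝ) ^ ((11 : ℝ) / 4) ≤ (clusterMaxIn ((box 3 n).filter fun z : Site 3 => 0 ≤ z 0) ω : ℝ)}
          ≤ Real.exp (-1) := by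
  sorry

/-- **stub_replicaOverlapMoments (OPEN hypothesis, new)**: REPLICA OVERLAP MOMENTS.  For two
INDEPENDENT samples `ω, ω'` of `P^{ℍ}_{p_c,s}`, the class-`j` window pair count `X_j(ω,ω')` — the
number of pairs `(v, w)`, `v ∈ ℍ₊` with `2^j ≤ |v|_∞ < 2^{j+1}`, `w` in the window `W_L = B_L + 2Le₀`,
such that `v ∈ C_ℍ(0)(ω)` and `v + w ∈ C_ℍ(e)(ω')` — has q-th moment
`≤ (C_q L³ (2^j)^{5/2})^q` in the far classes `2^j ≥ 8L`, for every `q ≥ 1`, uniformly in `s` and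
the floor neighbour `e`.  A statement about the LAW OF ONE wall cluster (two independent copies;
the `q = 1` member is a sum of products of two-point functions `Σ τ_ℍ(0,v) τ_ℍ(e,v+w)`); exponent
`5/2 = 2m - 3` at `m = 11/4`, real-world scale `L³ (2^j)^{2d_f-3} = L³ (2^j)^{2.05}` (margin 0.45). -/
theorem stub_replicaOverlapMoments :
    ∃ Cq : ℕ → ℝ, (∀ q : ℕ, 0 ≤ Cq q) ∧ ∀ q : ℕ, 1 ≤ q →
      ∀ s : unitInterval, ∀ e ∈ 𝒩, ∀ L : ℕ, 1 ≤ L → ∀ j : ℕ, 8 * L ≤ 2 ^ j →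
        ∫⁻ ω, ∫⁻ ω', (𝑿⟦e, L, j, ω, ω'⟧) ^ q
            ∂(floorDilutedPercolation 3 (criticalProbI 3) s) ∂(floorDilutedPercolation 3 (criticalProbI 3) s) ≤
          ENNReal.ofReal ((Cq q * (L : ℝ) ^ (3 : ℝ) * (((2 ^ j : ℕ)) : ℝ) ^ ((5 : ℝ) / 2)) ^ q) := by
  sorry

/-- **stub_replicaDecoupling (LEMMA)**: on the disjointness event `{0 ↮_ℍ e}` the q-th moment of the
pair count `X_j(ω,ω)` is at most the q-th moment of `X_j(ω,ω')` for two INDEPENDENT samples.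
Proof route: expand the q-th power into sums of products `Π_i 1{v_i ∈ C_ℍ(0)} · Π_i 1{v_i + w_i ∈
C_ℍ(e)}` of increasing cluster functionals; conditionally on `C_ℍ(0) = W` with `e ∉ W`, `C_ℍ(e)` is
percolation on the edges off `W̄`, whose law is dominated by the unconditioned cluster of `e`
(spatial Markov property + monotone coupling) — equivalently van den Berg–Häggström–Kahn 2006,
Thm 1.4 (conditional negative correlation given `0 ↮ e`) followed by Harris for the decreasing
event `{0 ↮ e}`; any product measure, so every `s`. -/
theorem stub_replicaDecoupling :
    ∀ s : unitInterval, ∀ e ∈ 𝒩, ∀ L j q : ℕ,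
      ∫⁻ ω, ((openConnIn ℍ₃ (0 : Site 3) e)ᶜ).indicator (fun _ => (1 : ℝ≥0∞)) ω * (𝑿⟦e, L, j, ω, ω⟧) ^ q
          ∂(floorDilutedPercolation 3 (criticalProbI 3) s) ≤
        ∫⁻ ω, ∫⁻ ω', (𝑿⟦e, L, j, ω, ω'⟧) ^ q
          ∂(floorDilutedPercolation 3 (criticalProbI 3) s) ∂(floorDilutedPercolation 3 (criticalProbI 3) s) := by
  sorry

/-- **stub_holderDyadic (LEMMA)**: the window pair bound from the four inputs.  Given `0 < κ ≤ 1/4`,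
`C₁ ≥ 0`, `C₂ > 0`, `C_q ≥ 0`, there is `C = C(κ, C₁, C₂, (C_q))` such that for every floor density `s`
and neighbour `e`: the two-arm bound `P_s(A_e(r)) ≤ C₁ r^{-(5/2+κ)}`, the rooted mass tails
`P_s(m_x(n) ≥ t C₂ n^{11/4}) ≤ e^{3/2} e^{-t/2}` (`x ∈ {0,e}`), the replica overlap moments and the
replica decoupling imply `Σ_{w ∈ W_L} Σ_{v ∈ ℍ₊} P_s(0 ↔ v, e ↔ v + w, 0 ↮ e) ≤ C L^{3-κ/2}`.
Proof route: Tonelli; dyadic classes of `v`; near classes `2^j < 8L` by the landed two-factor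
Markov truncation (`FloorRusso.near_class_le`-type, `min(2^j,L)^{-(5/2+κ)} 2^{11j/4} L^{11/4} log²L`);
far classes `2^j ≥ 8L` by Hölder `E[1_A X] ≤ P(A(2^{j-1}))^{1-1/q} E[1_D X^q]^{1/q}` with
`q = ⌈(5+2κ)/κ⌉ + 1`, decoupling and the moment bound: `≤ C L³ (2^j)^{-κ/2}`, geometric sum. -/
theorem stub_holderDyadic :
    ∀ κ C₁ C₂ : ℝ, ∀ Cq : ℕ → ℝ, 0 < κ → κ ≤ 1 / 4 → 0 ≤ C₁ → 0 < C₂ → (∀ q : ℕ, 0 ≤ Cq q) →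
      ∃ C : ℝ, ∀ s : unitInterval, ∀ e ∈ 𝒩,
        (∀ r : ℕ, 1 ≤ r →
          (floorDilutedPercolation 3 (criticalProbI 3) s).real 𝑱⟦e, r⟧ ≤ C₁ * (r : ℝ) ^ (-(5 / 2 + κ))) →
        (∀ x ∈ ({0, e} : Finset (Site 3)), ∀ n : ℕ, 1 ≤ n → ∀ t : ℝ, 1 ≤ t →
          (floorDilutedPercolation 3 (criticalProbI 3) s).real
            {ω | t * (C₂ * (n : ℝ) ^ ((11 : ℝ) / 4)) ≤ (((↑(box 3 (n)) : Set (Site 3)) ∩ {y : Site 3 | ω ∈ openConnIn {x : Site 3 | 0 ≤ x 0} x (x + y)}).ncard : ℝ)}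
              ≤ Real.exp (3 / 2) * Real.exp (-t / 2)) →
        (∀ q : ℕ, 1 ≤ q → ∀ L : ℕ, 1 ≤ L → ∀ j : ℕ, 8 * L ≤ 2 ^ j →
          ∫⁻ ω, ∫⁻ ω', (𝑿⟦e, L, j, ω, ω'⟧) ^ q
              ∂(floorDilutedPercolation 3 (criticalProbI 3) s) ∂(floorDilutedPercolation 3 (criticalProbI 3) s) ≤
            ENNReal.ofReal ((Cq q * (L : ℝ) ^ (3 : ℝ) * (((2 ^ j : ℕ)) : ℝ) ^ ((5 : ℝ) / 2)) ^ q)) →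
        (∀ L j q : ℕ,
          ∫⁻ ω, ((openConnIn ℍ₃ (0 : Site 3) e)ᶜ).indicator (fun _ => (1 : ℝ≥0∞)) ω * (𝑿⟦e, L, j, ω, ω⟧) ^ q
              ∂(floorDilutedPercolation 3 (criticalProbI 3) s) ≤
            ∫⁻ ω, ∫⁻ ω', (𝑿⟦e, L, j, ω, ω'⟧) ^ q
              ∂(floorDilutedPercolation 3 (criticalProbI 3) s) ∂(floorDilutedPercolation 3 (criticalProbI 3) s)) →
        ∀ L : ℕ, 1 ≤ L →
          ∑ w ∈ 𝑾⟦L⟧, ∑' v : {v : Site 3 // 1 ≤ v 0},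
              floorDilutedPercolation 3 (criticalProbI 3) s
                (openConnIn ℍ₃ 0 (v : Site 3) ∩ openConnIn ℍ₃ e ((v : Site 3) + w) ∩ (openConnIn ℍ₃ 0 e)ᶜ)
            ≤ ENNReal.ofReal (C * (L : ℝ) ^ (3 - κ / 2)) := by
  sorry

/-! ## Composition (no sorry below this line) -/

/-- A_s at all four floor neighbours from the single neighbour `(0,1,0)` (height-fixing signed
coordinate permutations of `ℤ³`; `Reduce.real_twoArm_signedPerm`, exponent-free). -/
theorem twoArmFloorDiluted_all :
    ∃ κ C : ℝ, 0 < κ ∧ ∀ s : unitInterval, ∀ e ∈ 𝒩, ∀ r : ℕ, 1 ≤ r →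
      (floorDilutedPercolation 3 (criticalProbI 3) s).real 𝑱⟦e, r⟧ ≤ C * (r : ℝ) ^ (-(5 / 2 + κ)) := by
  obtain ⟨κ, C, hκ, h⟩ := stub_twoArmFloorDilutedE1
  refine ⟨κ, C, hκ, fun s e he r hr => ?_⟩
  obtain ⟨π, ε, hπ, hε, rfl⟩ := FloorRusso.Reduce.exists_signedPerm_of_mem_nbrs he
  rw [FloorRusso.Reduce.real_twoArm_signedPerm π ε hπ hε]
  exact h s r hr

/-- B♯ on the five half-boxes from the origin half-box (`Reduce.noFatHalfBox_of_origin`). -/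
theorem noFatHalfBox_all :
    ∃ C : ℝ, 0 < C ∧ ∀ x ∈ insert (0 : Site 3) 𝒩, ∀ n : ℕ, 1 ≤ n →
      (floorDilutedPercolation 3 (criticalProbI 3) 1).real
        {ω | C * (n : ℝ) ^ ((11 : ℝ) / 4) ≤ (clusterMaxIn (((box 3 n).image fun y : Site 3 => x + y).filter fun z : Site 3 => 0 ≤ z 0) ω : ℝ)}
          ≤ Real.exp (-1) :=
  FloorRusso.Reduce.noFatHalfBox_of_origin stub_noFatHalfBoxOrigin

/-- **The window pair bound** `Σ_{w ∈ W_L} Σ_{v ∈ ℍ₊} P_s(0 ↔ v, e ↔ v+w, 0 ↮ e) ≤ C L^{3-κ/2}`,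
uniformly in `s` and `e`, from the five stubs. -/
theorem exists_pairBound :
    ∃ κ C : ℝ, 0 < κ ∧ 0 ≤ C ∧ ∀ s : unitInterval, ∀ e ∈ 𝒩, ∀ L : ℕ, 1 ≤ L →
      ∑ w ∈ 𝑾⟦L⟧, ∑' v : {v : Site 3 // 1 ≤ v 0},
          μH s (pivAt 0 e (v : Site 3) ((v : Site 3) + w)) ≤
        ENNReal.ofReal (C * (L : ℝ) ^ (3 - κ / 2)) := by
  obtain ⟨κ₀, C₀, hκ₀, hA⟩ := twoArmFloorDiluted_all
  obtain ⟨Cb, hCb, hB⟩ := noFatHalfBox_all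
  obtain ⟨hmap, htail⟩ := FloorRusso.stub_dilutionToolkit
  have hT := htail Cb hCb hB
  obtain ⟨Cq, hCq0, hR⟩ := stub_replicaOverlapMoments
  set κ : ℝ := min κ₀ (1 / 4) with hκdef
  set C₁ : ℝ := max C₀ 0 with hC₁def
  have hκ : 0 < κ := lt_min hκ₀ (by norm_num)
  have hκle : κ ≤ 1 / 4 := min_le_right _ _
  have hC₁ : 0 ≤ C₁ := le_max_right _ _
  have hC₂ : 0 < Cb + 1 := by linarith
  obtain ⟨C, hC⟩ := stub_holderDyadic κ C₁ (Cb + 1) Cq hκ hκle hC₁ hC₂ hCq0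
  refine ⟨κ, max C 0, hκ, le_max_right _ _, fun s e he L hL => ?_⟩
  have hA' : ∀ r : ℕ, 1 ≤ r → (floorDilutedPercolation 3 (criticalProbI 3) s).real 𝑱⟦e, r⟧ ≤
      C₁ * (r : ℝ) ^ (-(5 / 2 + κ)) := by
    intro r hr
    refine (hA s e he r hr).trans ?_
    have hr1 : (1 : ℝ) ≤ r := by exact_mod_cast hr
    have hpow : (r : ℝ) ^ (-(5 / 2 + κ₀)) ≤ (r : ℝ) ^ (-(5 / 2 + κ)) :=
      Real.rpow_le_rpow_of_exponent_le hr1 (by linarith [min_le_left κ₀ (1 / 4)])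
    calc C₀ * (r : ℝ) ^ (-(5 / 2 + κ₀)) ≤ C₁ * (r : ℝ) ^ (-(5 / 2 + κ₀)) :=
          mul_le_mul_of_nonneg_right (le_max_left _ _) (by positivity)
      _ ≤ C₁ * (r : ℝ) ^ (-(5 / 2 + κ)) := mul_le_mul_of_nonneg_left hpow hC₁
  have hT' : ∀ x ∈ ({0, e} : Finset (Site 3)), ∀ n : ℕ, 1 ≤ n → ∀ t : ℝ, 1 ≤ t →
      (floorDilutedPercolation 3 (criticalProbI 3) s).real
        {ω | t * ((Cb + 1) * (n : ℝ) ^ ((11 : ℝ) / 4)) ≤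
          (((↑(box 3 n) : Set (Site 3)) ∩ {y : Site 3 | ω ∈ openConnIn {x : Site 3 | 0 ≤ x 0} x (x + y)}).ncard : ℝ)} ≤
        Real.exp (3 / 2) * Real.exp (-t / 2) := by
    intro x hx
    have hx' : x ∈ insert (0 : Site 3) 𝒩 := by
      simp only [Finset.mem_insert, Finset.mem_singleton] at hx
      rcases hx with rfl | rfl
      · exact Finset.mem_insert_self _ _
      · exact Finset.mem_insert_of_mem he
    exact hT s x hx'
  have hR' : ∀ q : ℕ, 1 ≤ q → ∀ L : ℕ, 1 ≤ L → ∀ j : ℕ, 8 * L ≤ 2 ^ j →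
      ∫⁻ ω, ∫⁻ ω', (𝑿⟦e, L, j, ω, ω'⟧) ^ q
          ∂(floorDilutedPercolation 3 (criticalProbI 3) s) ∂(floorDilutedPercolation 3 (criticalProbI 3) s) ≤
        ENNReal.ofReal ((Cq q * (L : ℝ) ^ (3 : ℝ) * (((2 ^ j : ℕ)) : ℝ) ^ ((5 : ℝ) / 2)) ^ q) :=
    fun q hq L hL j hj => hR q hq s e he L hL j hj
  have hD' := fun L j q => stub_replicaDecoupling s e he L j q
  have h := hC s e he hA' hT' hR' hD' L hL
  refine h.trans (ENNReal.ofReal_le_ofReal ?_)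
  exact mul_le_mul_of_nonneg_right (le_max_left _ _) (by positivity)

/-- **Window sum bound**: `Σ_{w ∈ W_L} τ(0,w) ≤ |W_L| π_s(L) + 4 C L^{3-κ/2}` (landed
`Glue.windowSum_le` fed by `exists_pairBound`). -/
theorem exists_windowSum_bound :
    ∃ κ C : ℝ, 0 < κ ∧ 0 ≤ C ∧ ∀ L : ℕ, 1 ≤ L →
      ∑ w ∈ 𝑾⟦L⟧, μc (openConn (0 : Site 3) w) ≤
        (𝑾⟦L⟧).card * μc (𝑻⟦L⟧) +
          FloorRusso.Coupling.nbrs.card * ENNReal.ofReal (C * (L : ℝ) ^ (3 - κ / 2)) := by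
  obtain ⟨κ, C, hκ, hC, hpair⟩ := exists_pairBound
  obtain ⟨hmap, -⟩ := FloorRusso.stub_dilutionToolkit
  refine ⟨κ, C, hκ, hC, fun L hL => (FloorRusso.Glue.windowSum_le hmap L).trans (add_le_add le_rfl ?_)⟩
  refine (Finset.sum_le_sum fun e he => lintegral_mono fun s => hpair s e he L hL).trans (le_of_eq ?_)
  rw [lintegral_const, measure_univ, mul_one, Finset.sum_const, nsmul_eq_mul]

/-- **The window average of `τ_{p_c}(0,·)` tends to `0`** (real analysis, as in the landed
`Glue.tendsto_windowAverage`). -/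
theorem tendsto_windowAverage :
    Tendsto (fun L : ℕ => (∑ w ∈ 𝑾⟦L⟧, (μc).real (openConn (0 : Site 3) w)) / ((𝑾⟦L⟧).card : ℝ))
      atTop (𝓝 0) := by
  obtain ⟨κ, C, hκ, hC0, hbound⟩ := exists_windowSum_bound
  have h1 := FloorRusso.Glue.tendsto_tall0
  have h2 : Tendsto (fun L : ℕ => (FloorRusso.Coupling.nbrs.card : ℝ) * C * (L : ℝ) ^ (-(κ / 2))) atTop (𝓝 0) := by
    have h := (tendsto_rpow_neg_atTop (by linarith : 0 < κ / 2)).comp tendsto_natCast_atTop_atTop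
    simpa using h.const_mul ((FloorRusso.Coupling.nbrs.card : ℝ) * C)
  have h12 := h1.add h2
  rw [add_zero] at h12
  refine tendsto_of_tendsto_of_tendsto_of_le_of_le' tendsto_const_nhds h12
    (Eventually.of_forall fun L => div_nonneg (Finset.sum_nonneg fun _ _ => measureReal_nonneg)
      (Nat.cast_nonneg _)) ?_
  filter_upwards [eventually_ge_atTop 1] with L hL
  have hb := hbound L hL
  have hcardW := FloorRusso.Glue.card_window L
  set W := 𝑾⟦L⟧ with hW
  set T := 𝑻⟦L⟧ with hT
  have hcard : (W.card : ℝ) = (2 * (L : ℝ) + 1) ^ 3 := by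
    rw [hcardW]; push_cast; ring
  have hcard_pos : (0 : ℝ) < W.card := by rw [hcard]; positivity
  have hL3 : (L : ℝ) ^ (3 : ℝ) ≤ (W.card : ℝ) := by
    rw [hcard, show ((3 : ℝ)) = ((3 : ℕ) : ℝ) by norm_num, Real.rpow_natCast]
    have : (L : ℝ) ≤ 2 * (L : ℝ) + 1 := by linarith [(Nat.cast_nonneg L : (0 : ℝ) ≤ L)]
    exact pow_le_pow_left₀ (Nat.cast_nonneg L) this 3
  have hsum : ∑ w ∈ W, (μc).real (openConn (0 : Site 3) w) =
      (∑ w ∈ W, μc (openConn (0 : Site 3) w)).toReal := by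
    rw [ENNReal.toReal_sum fun _ _ => measure_ne_top _ _]; rfl
  have hfin : (W.card : ℝ≥0∞) * μc T +
      FloorRusso.Coupling.nbrs.card * ENNReal.ofReal (C * (L : ℝ) ^ (3 - κ / 2)) ≠ ∞ := by
    refine ENNReal.add_ne_top.2 ⟨ENNReal.mul_ne_top (by simp) (measure_ne_top _ _), ?_⟩
    exact ENNReal.mul_ne_top (by simp) ENNReal.ofReal_ne_top
  have hb' : ∑ w ∈ W, (μc).real (openConn (0 : Site 3) w) ≤
      (W.card : ℝ) * (μc).real T + (FloorRusso.Coupling.nbrs.card : ℝ) * (C * (L : ℝ) ^ (3 - κ / 2)) := by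
    rw [hsum]
    have := ENNReal.toReal_mono hfin hb
    rw [ENNReal.toReal_add (ENNReal.mul_ne_top (by simp) (measure_ne_top _ _))
      (ENNReal.mul_ne_top (by simp) ENNReal.ofReal_ne_top), ENNReal.toReal_mul,
      ENNReal.toReal_mul, ENNReal.toReal_ofReal (by positivity)] at this
    simpa [measureReal_def] using this
  rw [div_le_iff₀ hcard_pos]
  have hLpos : (0 : ℝ) < L := by exact_mod_cast hL
  have hsplit : (L : ℝ) ^ (3 - κ / 2) = (L : ℝ) ^ (3 : ℝ) * (L : ℝ) ^ (-(κ / 2)) := by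
    rw [← Real.rpow_add hLpos]; ring_nf
  calc ∑ w ∈ W, (μc).real (openConn (0 : Site 3) w)
      ≤ (W.card : ℝ) * (μc).real T + (FloorRusso.Coupling.nbrs.card : ℝ) * (C * (L : ℝ) ^ (3 - κ / 2)) := hb'
    _ = (W.card : ℝ) * (μc).real T +
        (FloorRusso.Coupling.nbrs.card : ℝ) * C * (L : ℝ) ^ (-(κ / 2)) * (L : ℝ) ^ (3 : ℝ) := by
          rw [hsplit]; ring
    _ ≤ (W.card : ℝ) * (μc).real T +
        (FloorRusso.Coupling.nbrs.card : ℝ) * C * (L : ℝ) ^ (-(κ / 2)) * (W.card : ℝ) := by gcongr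
    _ = ((μc).real T + (FloorRusso.Coupling.nbrs.card : ℝ) * C * (L : ℝ) ^ (-(κ / 2))) * (W.card : ℝ) := by
        ring

/-- **`θ(p_c(ℤ³)) = 0` from the stubs** (window average and `θ² ≤ τ(0,w)` for every `w`). -/
theorem percolationContinuityZ3_of_stubs : _root_.PercolationContinuityZ3 := by
  show theta (zdGraph 3) (0 : Site 3) (criticalProbI 3) = 0
  set θ := theta (zdGraph 3) (0 : Site 3) (criticalProbI 3) with hθ
  have hsq : θ ^ 2 ≤ 0 := by
    refine ge_of_tendsto' tendsto_windowAverage fun L => ?_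
    have hne : (𝑾⟦L⟧).Nonempty :=
      ⟨(0 : Site 3) + Pi.single 0 (((2 * L : ℕ)) : ℤ), Finset.mem_image_of_mem _ (zero_mem_box 3 L)⟩
    set W := 𝑾⟦L⟧ with hW
    have hc : (0 : ℝ) < (W.card : ℝ) := by exact_mod_cast Finset.card_pos.mpr hne
    show θ ^ 2 ≤ (∑ w ∈ W, (μc).real (openConn (0 : Site 3) w)) / (W.card : ℝ)
    rw [le_div_iff₀ hc, mul_comm, ← nsmul_eq_mul, ← Finset.sum_const]
    exact Finset.sum_le_sum fun w _ => Grimmett1999_theta_sq_le_openConn_holds 3 (criticalProbI 3) 0 w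
  exact pow_eq_zero_iff two_ne_zero |>.1 (le_antisymm hsq (sq_nonneg _))

/-- **Composition: the crux `LowPointBookkeeping` from the five stubs** (K ⟺ Assembly, landed
`LowPointBookkeeping.Negative.lowPointBookkeeping_iff_assembly`; the conjunct closes the Assembly). -/
theorem LowPointBookkeeping_of : LowPointBookkeeping :=
  LowPointBookkeeping.Negative.lowPointBookkeeping_iff_assembly.2
    fun _ _ _ => percolationContinuityZ3_of_stubs

/-- The route's crux A (`BoundaryTwoArmDecay`) is the case `s = 1`, `e = (0,1,0)` of A_s
(`Glue.floorDiluted_one_real_twoArm`): the line's two-arm input sits AT crux A's exponent. -/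
theorem boundaryTwoArmDecay_of_stubs : BoundaryTwoArmDecay := by
  obtain ⟨κ, C, hκ, h⟩ := twoArmFloorDiluted_all
  have he : (Pi.single 1 1 : Site 3) ∈ 𝒩 := Finset.mem_insert_self _ _
  refine ⟨κ, max C 0, hκ, fun r hr => ?_⟩
  have h1 := h 1 _ he r hr
  rw [FloorRusso.Glue.floorDiluted_one_real_twoArm] at h1
  refine le_trans (le_of_eq ?_) (h1.trans ?_)
  · congr 1
    ext ω
    simp only [Set.mem_inter_iff, Set.mem_setOf_eq, Set.mem_compl_iff, and_assoc]
  · exact mul_le_mul_of_nonneg_right (le_max_left _ _) (by positivity)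

end Summit.CriticalPhenomena.PercolationContinuityZ3.Cruxes.LowPointBookkeeping.ReplicaHolder

end
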